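import Mathlib
import Summits.Ventures.PercRepro0.HarrisCyl
import Summits.Ventures.PercRepro0.HarrisApprox

/-!
# P7 · HARRIS–FKG in infinite volume on the cell's definitions (seat p3)

Kernel-checked twin of proofs/P7-fkg-p3-v1.md Theorem 7.5 (for indicator functions) on Mathlib's
`setBernoulli u p`, hence on `Defs.P d p`: for increasing measurable events `A`, `B`,
`P_p(A ∩ B) ≥ P_p(A) P_p(B)`.  The conditioning on a finite coordinate set `J` of the paper proof
is made explicit by sections instead of conditional expectations (`HarrisCyl.lean`), the cylinder
approximation is `HarrisApprox.lean`, and here: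

* `harris_finite` — Lemma 7.2 (finite-volume Harris) on the lattice `J → Bool` with the product
  weights `wt J p`, from Mathlib's Fortuin–Kasteleyn–Ginibre inequality `fkg` (four functions
  theorem) and the log-modularity `wt_inf_mul_wt_sup`;
* `real_sect_inter_ge` — the pointwise estimate `P(A_η ∩ B_η) ≥ P(A_η) P(B_η) − 2 P((A ∆ C)_η)`
  for `C` determined by `J` (§4 Steps 2–3 made quantitative);
* `real_mul_le_real_inter` / `setBernoulli_mul_le_inter` — Theorem 7.5: finite-volume Harris on the
  monotone functions `η ↦ P(A_η)`, `η ↦ P(B_η)`, the decomposition over the atoms, the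
  approximation, and `ε → 0`;
* `P7_FKG_holds` — `Defs.P7_FKG d` for every `d` (the route's P7, unconditional): the hypothesis
  `∀ d, P7_FKG d` of `HighD.THD_of_chain` is discharged.
-/

namespace Summit.Ventures.PercRepro0.Harris

open MeasureTheory ProbabilityTheory unitInterval Set Defs
open scoped ENNReal NNReal symmDiff

variable {ι : Type*}

/-! ## Lemma 7.2: finite-volume Harris on the atoms of `J` -/

section Finite

variable [DecidableEq ι] (J : Finset ι) (p : I)

/-- Lemma 7.2 (finite-volume Harris–FKG) on the lattice `J → Bool`: for the product weights
`wt J p` (summing to `1`) and monotone non-negative `f`, `g`,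
`(Σ wt f) (Σ wt g) ≤ Σ wt (f g)` — Mathlib's `fkg` with the log-modular weight `wt J p`. -/
theorem harris_finite (hsum : ∑ η : J → Bool, wt J p η = 1) (f g : (J → Bool) → ℝ)
    (hf₀ : 0 ≤ f) (hg₀ : 0 ≤ g) (hf : Monotone f) (hg : Monotone g) :
    (∑ η : J → Bool, wt J p η * f η) * (∑ η : J → Bool, wt J p η * g η) ≤
      ∑ η : J → Bool, wt J p η * (f η * g η) := by
  have h := fkg f g (wt J p) (fun η => wt_nonneg J p η) hf₀ hg₀ hf hg
    (fun a b => (wt_inf_mul_wt_sup J p a b).symm.le)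
  rwa [hsum, one_mul] at h

end Finite

/-! ## Theorem 7.5: Harris–FKG for increasing measurable events -/

section Main

variable (u : Set ι) (p : I)

/-- The pointwise estimate along a pattern (§4 Steps 2–3, quantitative): for `C` determined by `J`,
`P(A_η ∩ B_η) ≥ P(A_η) P(B_η) − 2 P((A ∆ C)_η)`. -/
theorem real_sect_inter_ge (J : Finset ι) (η : J → Bool) {A B C : Set (Set ι)}
    (hC : DeterminedBy J C) :
    (setBernoulli u p).real (sect J η A) * (setBernoulli u p).real (sect J η B)
      - 2 * (setBernoulli u p).real (sect J η (A ∆ C))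
      ≤ (setBernoulli u p).real (sect J η (A ∩ B)) := by
  have hA1 : (setBernoulli u p).real (sect J η A) ≤ 1 := measureReal_le_one
  have hA0 : 0 ≤ (setBernoulli u p).real (sect J η A) := measureReal_nonneg
  have hB1 : (setBernoulli u p).real (sect J η B) ≤ 1 := measureReal_le_one
  have hB0 : 0 ≤ (setBernoulli u p).real (sect J η B) := measureReal_nonneg
  have hD0 : 0 ≤ (setBernoulli u p).real (sect J η (A ∆ C)) := measureReal_nonneg
  have hAB0 : 0 ≤ (setBernoulli u p).real (sect J η (A ∩ B)) := measureReal_nonneg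
  by_cases hc : (∅ : Set ι) ∈ sect J η C
  · -- every section of `C` is full, so `B_η ⊆ (A ∩ B)_η ∪ (A ∆ C)_η`
    have hsub : sect J η B ⊆ sect J η (A ∩ B) ∪ sect J η (A ∆ C) := by
      intro ω hω
      by_cases hωA : ω ∈ sect J η A
      · exact Or.inl ⟨hωA, hω⟩
      · refine Or.inr ?_
        have hωC : ω ∈ sect J η C := (sect_determined J η hC ∅ ω).1 hc
        exact Set.mem_symmDiff.2 (Or.inr ⟨hωC, hωA⟩)
    have h1 : (setBernoulli u p).real (sect J η B) ≤
        (setBernoulli u p).real (sect J η (A ∩ B)) + (setBernoulli u p).real (sect J η (A ∆ C)) :=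
      (measureReal_mono hsub).trans (measureReal_union_le _ _)
    have h2 : (setBernoulli u p).real (sect J η A) * (setBernoulli u p).real (sect J η B) ≤
        (setBernoulli u p).real (sect J η B) :=
      mul_le_of_le_one_left hB0 hA1
    linarith
  · -- every section of `C` is empty, so `A_η ⊆ (A ∆ C)_η`
    have hsub : sect J η A ⊆ sect J η (A ∆ C) := by
      intro ω hω
      have hωC : ω ∉ sect J η C := fun h => hc ((sect_determined J η hC ω ∅).1 h)
      exact Set.mem_symmDiff.2 (Or.inl ⟨hω, hωC⟩)
    have h1 : (setBernoulli u p).real (sect J η A) ≤ (setBernoulli u p).real (sect J η (A ∆ C)) :=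
      measureReal_mono hsub
    have h2 : (setBernoulli u p).real (sect J η A) * (setBernoulli u p).real (sect J η B) ≤
        (setBernoulli u p).real (sect J η A) :=
      mul_le_of_le_one_right hA0 hB1
    linarith

variable [DecidableEq ι]

/-- Theorem 7.5 (Harris–FKG, real form): for increasing measurable events `A`, `B`,
`P(A) P(B) ≤ P(A ∩ B)` under `setBernoulli u p`.  Proof: approximate `A` by an event `C` determined
by a finite `J ⊆ u` (Lemma 7.3), decompose the four events `A`, `B`, `A ∩ B`, `A ∆ C` over the atoms
of `J` (Lemma 7.4(b)), apply finite-volume Harris to the monotone weights `η ↦ P(A_η)`, `η ↦ P(B_η)`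
(Lemma 7.2) and the pointwise estimate, and let the approximation error go to `0`. -/
theorem real_mul_le_real_inter {A B : Set (Set ι)} (hA : IsUpperSet A) (hB : IsUpperSet B)
    (mA : MeasurableSet A) (mB : MeasurableSet B) :
    (setBernoulli u p).real A * (setBernoulli u p).real B ≤ (setBernoulli u p).real (A ∩ B) := by
  refine le_of_forall_pos_lt_add fun ε hε => ?_
  obtain ⟨J, hJ, C, hC, hCm, hlt⟩ := exists_determinedBy_symmDiff_lt u p mA (half_pos hε)
  -- the functions `η ↦ P(A_η)`, `η ↦ P(B_η)` are monotone and non-negative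
  have hφA : Monotone fun η : J → Bool => (setBernoulli u p).real (sect J η A) :=
    fun _ _ h => measureReal_mono (sect_mono_of_isUpperSet J hA h)
  have hφB : Monotone fun η : J → Bool => (setBernoulli u p).real (sect J η B) :=
    fun _ _ h => measureReal_mono (sect_mono_of_isUpperSet J hB h)
  have hφA0 : 0 ≤ fun η : J → Bool => (setBernoulli u p).real (sect J η A) :=
    fun _ => measureReal_nonneg
  have hφB0 : 0 ≤ fun η : J → Bool => (setBernoulli u p).real (sect J η B) :=
    fun _ => measureReal_nonneg
  -- finite-volume Harris (Lemma 7.2) on the atoms of `J`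
  have hfkg : (∑ η : J → Bool, wt J p η * (setBernoulli u p).real (sect J η A)) *
      (∑ η : J → Bool, wt J p η * (setBernoulli u p).real (sect J η B)) ≤
      ∑ η : J → Bool, wt J p η *
        ((setBernoulli u p).real (sect J η A) * (setBernoulli u p).real (sect J η B)) :=
    harris_finite J p (sum_wt J u p hJ) _ _ hφA0 hφB0 hφA hφB
  -- the decompositions over the atoms (Lemma 7.4(b))
  have hdA := real_eq_sum_sect J u p hJ mA
  have hdB := real_eq_sum_sect J u p hJ mB
  have hdAB := real_eq_sum_sect J u p hJ (mA.inter mB)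
  have hdD := real_eq_sum_sect J u p hJ (mA.symmDiff hCm)
  -- the pointwise estimate, summed with the weights
  have hpt : ∑ η : J → Bool, wt J p η *
      ((setBernoulli u p).real (sect J η A) * (setBernoulli u p).real (sect J η B)
        - 2 * (setBernoulli u p).real (sect J η (A ∆ C)))
      ≤ ∑ η : J → Bool, wt J p η * (setBernoulli u p).real (sect J η (A ∩ B)) :=
    Finset.sum_le_sum fun η _ =>
      mul_le_mul_of_nonneg_left (real_sect_inter_ge u p J η hC) (wt_nonneg J p η)
  have hsplit : ∑ η : J → Bool, wt J p η *
      ((setBernoulli u p).real (sect J η A) * (setBernoulli u p).real (sect J η B)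
        - 2 * (setBernoulli u p).real (sect J η (A ∆ C)))
      = ∑ η : J → Bool, wt J p η *
          ((setBernoulli u p).real (sect J η A) * (setBernoulli u p).real (sect J η B))
        - 2 * ∑ η : J → Bool, wt J p η * (setBernoulli u p).real (sect J η (A ∆ C)) := by
    rw [Finset.mul_sum, ← Finset.sum_sub_distrib]
    exact Finset.sum_congr rfl fun η _ => by ring
  -- assemble
  calc (setBernoulli u p).real A * (setBernoulli u p).real B
      = (∑ η : J → Bool, wt J p η * (setBernoulli u p).real (sect J η A)) *
          (∑ η : J → Bool, wt J p η * (setBernoulli u p).real (sect J η B)) := by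
        rw [hdA, hdB]
    _ ≤ ∑ η : J → Bool, wt J p η *
          ((setBernoulli u p).real (sect J η A) * (setBernoulli u p).real (sect J η B)) := hfkg
    _ = ∑ η : J → Bool, wt J p η *
          ((setBernoulli u p).real (sect J η A) * (setBernoulli u p).real (sect J η B)
            - 2 * (setBernoulli u p).real (sect J η (A ∆ C)))
          + 2 * (setBernoulli u p).real (A ∆ C) := by
        rw [hsplit, hdD]; ring
    _ ≤ ∑ η : J → Bool, wt J p η * (setBernoulli u p).real (sect J η (A ∩ B))
          + 2 * (setBernoulli u p).real (A ∆ C) := by linarith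
    _ = (setBernoulli u p).real (A ∩ B) + 2 * (setBernoulli u p).real (A ∆ C) := by rw [hdAB]
    _ < (setBernoulli u p).real (A ∩ B) + ε := by linarith

/-- Theorem 7.5 (Harris–FKG): `P(A) P(B) ≤ P(A ∩ B)` for increasing measurable events `A`, `B`
under `setBernoulli u p` (any index type, any `u`, any `p`). -/
theorem setBernoulli_mul_le_inter {A B : Set (Set ι)} (hA : IsUpperSet A) (hB : IsUpperSet B)
    (mA : MeasurableSet A) (mB : MeasurableSet B) :
    setBernoulli u p A * setBernoulli u p B ≤ setBernoulli u p (A ∩ B) := by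
  have h := real_mul_le_real_inter u p hA hB mA mB
  simp only [measureReal_def] at h
  rw [← ENNReal.toReal_mul] at h
  exact (ENNReal.toReal_le_toReal (ENNReal.mul_ne_top (measure_ne_top _ _) (measure_ne_top _ _))
    (measure_ne_top _ _)).1 h

end Main

/-! ## P7 on the cell's definitions -/

/-- P7 · FKG/HARRIS for the percolation measure `P d p`, every `d`: increasing measurable events are
positively correlated — the hypothesis `∀ d, P7_FKG d` of `HighD.THD_of_chain`, discharged. -/
theorem P7_FKG_holds (d : ℕ) : Defs.P7_FKG d := by
  classical
  intro p A B hA hB mA mB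
  exact setBernoulli_mul_le_inter (bonds d) p hA hB mA mB

end Summit.Ventures.PercRepro0.Harris
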